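import Mathlib

/-!
# Comb lemma, layer 0: the unique zero of a strictly monotone continuous family

Pure real analysis used by the corrected comb lemma (line `heteroclinic_comb` of crux
`LaminatedThreshold`, Stub 1 re-typed in adapted coordinates): if `F x ·` is continuous and strictly
increasing on `[a, b]` with `F x a < 0 < F x b`, jointly continuously in `(x, t)`, then the unique
zero `t = h x` depends continuously on `x`. This is the implicit-function step of the backward graph
transform, done with the intermediate value theorem instead of derivatives.
-/

set_option linter.dupNamespace false

namespace Summit.FinalStateConjecture.FinalStateConjecture.Theorems.LaminatedThreshold.Comb

open Set Filter Topology

/-- **Continuity of the unique zero.** Let `F : X → ℝ → ℝ` be jointly continuous on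
`S ×ˢ [a, b]`, strictly increasing in the real variable on `[a, b]` for every `x ∈ S`, with
`F x a < 0 < F x b`. Then there is `h : X → ℝ`, continuous on `S`, with `h x ∈ (a, b)` and
`F x (h x) = 0` for `x ∈ S`, and `h x` is the only zero of `F x` in `[a, b]`. [folklore] -/
theorem exists_continuousOn_zero : ∀ {X : Type*} [TopologicalSpace X] (F : X → ℝ → ℝ) (S : Set X) {a b : ℝ}, a ≤ b → ContinuousOn (fun p : X × ℝ ↦ F p.1 p.2) (S ×ˢ Set.Icc a b) → (∀ x ∈ S, StrictMonoOn (F x) (Set.Icc a b)) → (∀ x ∈ S, F x a < 0) → (∀ x ∈ S, 0 < F x b) → ∃ h : X → ℝ, ContinuousOn h S ∧ (∀ x ∈ S, h x ∈ Set.Ioo a b ∧ F x (h x) = 0) ∧ ∀ x ∈ S, ∀ t ∈ Set.Icc a b, F x t = 0 → t = h x := by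
  intro X _ F S a b hab hcont hmono ha hb
  -- continuity of each partial map `F x ·` on `[a, b]` and of `F · t` on `S`
  have hFx : ∀ x ∈ S, ContinuousOn (F x) (Icc a b) := by
    intro x hx
    have hmap : MapsTo (fun t : ℝ ↦ (x, t)) (Icc a b) (S ×ˢ Icc a b) := fun t ht ↦ ⟨hx, ht⟩
    exact hcont.comp (continuousOn_const.prodMk continuousOn_id) hmap
  have hFt : ∀ t ∈ Icc a b, ContinuousOn (fun x ↦ F x t) S := by
    intro t ht
    have hmap : MapsTo (fun x : X ↦ (x, t)) S (S ×ˢ Icc a b) := fun x hx ↦ ⟨hx, ht⟩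
    exact hcont.comp (continuousOn_id.prodMk continuousOn_const) hmap
  -- existence of a zero in the open interval, by the intermediate value theorem
  have hex : ∀ x ∈ S, ∃ t, t ∈ Ioo a b ∧ F x t = 0 := by
    intro x hx
    have hmem : (0 : ℝ) ∈ Icc (F x a) (F x b) := ⟨(ha x hx).le, (hb x hx).le⟩
    obtain ⟨t, ht, ht0⟩ := intermediate_value_Icc hab (hFx x hx) hmem
    refine ⟨t, ⟨lt_of_le_of_ne ht.1 ?_, lt_of_le_of_ne ht.2 ?_⟩, ht0⟩
    · rintro rfl; exact (ha x hx).ne ht0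
    · rintro rfl; exact (hb x hx).ne' ht0
  choose! h hh using hex
  -- uniqueness
  have huniq : ∀ x ∈ S, ∀ t ∈ Icc a b, F x t = 0 → t = h x := by
    intro x hx t ht ht0
    have h1 : F x t = F x (h x) := by rw [ht0, (hh x hx).2]
    exact (hmono x hx).injOn ht (Ioo_subset_Icc_self (hh x hx).1) h1
  refine ⟨h, ?_, hh, huniq⟩
  -- continuity on `S`, by the order characterisation of limits in `ℝ`
  intro x₀ hx₀
  have hx₀ab : h x₀ ∈ Ioo a b := (hh x₀ hx₀).1
  rw [ContinuousWithinAt, tendsto_order]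
  constructor
  · intro a' ha'
    set t₁ : ℝ := max a' a with ht₁
    have ht₁lt : t₁ < h x₀ := max_lt ha' hx₀ab.1
    have ht₁mem : t₁ ∈ Icc a b := ⟨le_max_right _ _, (ht₁lt.trans hx₀ab.2).le⟩
    have hneg : F x₀ t₁ < 0 := by
      rw [← (hh x₀ hx₀).2]
      exact hmono x₀ hx₀ ht₁mem (Ioo_subset_Icc_self hx₀ab) ht₁lt
    have hev : ∀ᶠ x in 𝓝[S] x₀, F x t₁ < 0 :=
      (tendsto_order.1 ((hFt t₁ ht₁mem).continuousWithinAt hx₀)).2 0 hneg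
    filter_upwards [hev, self_mem_nhdsWithin] with x hxneg hx
    have hlt : t₁ < h x := by
      by_contra hle
      push Not at hle
      have hxab : h x ∈ Ioo a b := (hh x hx).1
      have hmon := (hmono x hx).monotoneOn
      have : F x (h x) ≤ F x t₁ := hmon (Ioo_subset_Icc_self hxab) ht₁mem hle
      rw [(hh x hx).2] at this
      linarith
    exact lt_of_le_of_lt (le_max_left _ _) hlt
  · intro b' hb'
    set t₂ : ℝ := min b' b with ht₂
    have ht₂gt : h x₀ < t₂ := lt_min hb' hx₀ab.2
    have ht₂mem : t₂ ∈ Icc a b := ⟨(hx₀ab.1.trans ht₂gt).le, min_le_right _ _⟩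
    have hpos : 0 < F x₀ t₂ := by
      rw [← (hh x₀ hx₀).2]
      exact hmono x₀ hx₀ (Ioo_subset_Icc_self hx₀ab) ht₂mem ht₂gt
    have hev : ∀ᶠ x in 𝓝[S] x₀, 0 < F x t₂ :=
      (tendsto_order.1 ((hFt t₂ ht₂mem).continuousWithinAt hx₀)).1 0 hpos
    filter_upwards [hev, self_mem_nhdsWithin] with x hxpos hx
    have hlt : h x < t₂ := by
      by_contra hle
      push Not at hle
      have hxab : h x ∈ Ioo a b := (hh x hx).1
      have hmon := (hmono x hx).monotoneOn
      have : F x t₂ ≤ F x (h x) := hmon ht₂mem (Ioo_subset_Icc_self hxab) hle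
      rw [(hh x hx).2] at this
      linarith
    exact lt_of_lt_of_le hlt (min_le_left _ _)

end Summit.FinalStateConjecture.FinalStateConjecture.Theorems.LaminatedThreshold.Comb
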